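import Summits.ResolutionOfSingularities.ResolutionOfSingularities.Theorems.PurelyInseparableDim4ResConeTiltedCorner
import HarnessLib
import HarnessLib.Audit.Tags

/-!
# Purely inseparable four-folds — NO PASSIVE-FREE BINARY-CONE PAIR TAIL at `(p, d) = (5, 4)`, TILTED OR NOT: the end
# game in moving frames and the headline of brick (ii) (K2(p) lane, SLICE C, «tilted reduction», FILE 3d-β;
# file-holder res-dim4-p-5 g4)

[OURS · counted 0 · cell `res-dim4-pi` · K2(p) lane, slice C (desk WORD #155) · seat p-5 g4.]
Nothing here proves K2(p)/K2(5), `NoIsolatedTrap p p` or resolution of singularities in dimension ≥ 4 / char. `p`.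

idea-4 E2 §D END GAME read in the MOVING FRAME `φ_m` (the `a`-tilt of the current state; `e_{a′}` is exact after a
lose-both pair by `…TiltedLoseBoth`):
* **`tilted_corner_of_seed45`** — from a half-straight `(2,1)`-state whose frame cone `shear a φ F_m` carries
  `x_a⁴x_{a′}⁵` and no `x_a²x_{a′}⁵x_i`, the step is the corner `T_a` at the frame point (`b m = φ`), and the child is
  again such a state in its own frame `φ₁` (marker transported by `corner_frame_step` + `coeff_jet_eq_of_noSource`;
  lose-both steps killed by `loseBoth_jet_kill(_swap)`, keeping `a` by `false_of_keep`);
* **`tilted_false_of_seed44`** — from such a state carrying `x_a⁴x_{a′}⁴` no step is possible (the corner child would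
  carry `x_a³x_{a′}⁴` in its frame, against `free_of_straighten_one`);
* `false_of_tilted_loseBoth` — after ANY lose-both step of a lossy pair tail: seed 44 dies at once, seed 45 makes
  every later step a corner at the frame point, so no boundary letter is translated again — against LOSSY;
* **`no_lossy_pair_tail_four_five`** — NO LOSSY passive-free binary-cone tail with chart letters in `{a, a′}` at
  `(5, 4)`, with NO tilt-freeness hypothesis (brick (i)'s `no_lossy_tiltFree_pair_tail_four_five` minus `htilt`);
* **`no_pair_tail_four_five`** — HEADLINE: no passive-free `e_G = 2` tail of shade `4` with chart letters in a pair
  at all (the eventually loss-free case is res-dim4-p-5 g3's `…LossFreeTail.no_lossfree_tail`).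
Riders: `p = 5 = d + 1` throughout; chart letters outside the pair and a passive BOUNDARY letter (B∞) are NOT
covered here (hypotheses `hletters`, `hpass`); K2(5) stays OPEN.
[cite: CossartJannsenSaito2020, Thm. 3.14, Lemma 13.2, Thm. 13.7] [cite: Hauser2010, §I (definition of P⁺, kangaroo phenomenon)]
bears_on: LADDER-RESOLUTION:D157-DOOR2 (res-dim4-pi · K2(p) = `RidgeBudget.NoAboveFloorTrap p p` · slice C, tilted residual).
Supports stmt-ResolutionOfSingularities-16155 (helper).
-/

set_option linter.dupNamespace false -- mandated namespace of this single-conjunct summit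

noncomputable section

namespace Summit.ResolutionOfSingularities.ResolutionOfSingularities.Theorems.PIDim4

namespace ResCone

open MvPolynomial Finset
open Literature.AlgebraicGeometry.Resolution
open Literature.AlgebraicGeometry.Resolution.CentreBlowup
open Literature.AlgebraicGeometry.Resolution.Hauser2010
open Literature.AlgebraicGeometry.Resolution.HauserPerlega2019
open PointBlowup (direction)

variable {K : Type} [Field K] [CharP K 5] [DecidableEq K]

section TiltedEndGame

/-- **TILTED END GAME, SEED `x_a⁴x_{a′}⁵`: THE STEP IS THE CORNER AT THE FRAME POINT, AND THE INVARIANT PERSISTS.**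
From a half-straight `(2,1)`-state `m` (`e_{a′} ∈ Vtx`, `e_a + φ ∈ Vtx`) whose frame cone `G = shear a φ F_m` has
`coeff_{x_a⁴x_{a′}⁵} G ≠ 0` and `coeff_{x_a²x_{a′}⁵x_i} G = 0` (inert `i`): the step is `T_a` at `b m = φ`, the child is
a half-straight `(2,1)`-state, and for its `a`-tilt `φ₁` the frame cone `shear a φ₁ F_{m+1}` again carries
`x_a⁴x_{a′}⁵` and no `x_a²x_{a′}⁵x_i` (the jet's only sources for these are exactly the absent monomials). [OURS]
[cite: CossartJannsenSaito2020, Lemma 13.2, Thm. 13.7] [cite: Hauser2010, §I (kangaroo phenomenon)] -/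
theorem tilted_corner_of_seed45 {c : ℕ → State K} {j : ℕ → Fin 4} {b : ℕ → Fin 4 → K}
    (hc : ∀ k, IsIsolated 5 (c k).F ∧ Step0 5 (c k) (c (k + 1))) (hw : FreeTail.IsWitnessedChain 5 c j b)
    (hr0 : ∀ e ∈ (c 0).F.support, (c 0).r ≤ e) (hfloor : ∀ k, ordZero (c k).F ≠ 5) {k₀ : ℕ}
    (hshade : ∀ k, k₀ ≤ k → (c k).shade = ((4 : ℕ) : ℕ∞))
    (he : ∀ k, k₀ ≤ k → Module.finrank K (resVertex (c k)) = 2) {a a' : Fin 4} (haa : a ≠ a')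
    (hletters : ∀ k, k₀ ≤ k → (j k = a ∨ j k = a'))
    (hpass : ∀ k, k₀ ≤ k → ∀ i, i ≠ a → i ≠ a' → (c k).r i = 0)
    {m : ℕ} (hm : k₀ ≤ m) (hrm : (c m).r = Finsupp.single a 2 + Finsupp.single a' 1)
    (hVa' : (Pi.single a' 1 : Fin 4 → K) ∈ resVertex (c m)) {φ : Fin 4 → K} (hφa : φ a = 0) (hφa' : φ a' = 0)
    (hφV : (Pi.single a 1 : Fin 4 → K) + φ ∈ resVertex (c m))
    (h45 : coeff (Finsupp.single a 4 + Finsupp.single a' 5) (shear a φ (c m).F) ≠ 0)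
    (h25 : ∀ i, i ≠ a → i ≠ a' →
      coeff (Finsupp.single a 2 + Finsupp.single a' 5 + Finsupp.single i 1) (shear a φ (c m).F) = 0) :
    b m = φ ∧ (c (m + 1)).r = Finsupp.single a 2 + Finsupp.single a' 1 ∧
    (Pi.single a' 1 : Fin 4 → K) ∈ resVertex (c (m + 1)) ∧
    ∃ φ₁ : Fin 4 → K, φ₁ a = 0 ∧ φ₁ a' = 0 ∧ (Pi.single a 1 : Fin 4 → K) + φ₁ ∈ resVertex (c (m + 1)) ∧
      coeff (Finsupp.single a 4 + Finsupp.single a' 5) (shear a φ₁ (c (m + 1)).F) ≠ 0 ∧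
      ∀ i, i ≠ a → i ≠ a' →
        coeff (Finsupp.single a 2 + Finsupp.single a' 5 + Finsupp.single i 1) (shear a φ₁ (c (m + 1)).F) = 0 := by
  haveI : Fact (Nat.Prime 5) := ⟨by norm_num⟩
  have hdeg45 : (Finsupp.single a 4 + Finsupp.single a' 5 : Fin 4 →₀ ℕ).degree = 9 := by
    rw [map_add, Finsupp.degree_single, Finsupp.degree_single]
  rcases hletters m hm with hja | hja'
  · by_cases htm : b m a' = 0
    · obtain ⟨hbm, hr1, hVa'1, φ₁, hφ₁a, hφ₁a', hφ₁V, hS⟩ := corner_frame_step hc hw hr0 hfloor hshade he haa hletters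
        hpass hm hrm hVa' hφa hφa' hφV hja htm
      have hG7 := straight_rows hc hr0 hfloor hshade haa hpass hm hrm hVa' hφa hφa' hφV
      refine ⟨hbm, hr1, hVa'1, φ₁, hφ₁a, hφ₁a', hφ₁V, ?_, ?_⟩
      · -- the marker `x_a⁴x_{a′}⁵` is its own chart preimage and has no jet source
        have h := hS (Finsupp.single a 4 + Finsupp.single a' 5) (by rw [hdeg45]; omega)
          (by rw [chartExponent_two_left haa 4 5 4 rfl]
              exact not_isPthPowerExponent_of_not_dvd (i := a) (by rw [two_apply haa, if_pos rfl]; omega))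
        rw [chartExponent_two_left haa 4 5 4 rfl, coeff_jet_eq_of_noSource haa φ₁ hφ₁a hφ₁a'
          (fun e he hlt hd hc => by
            rw [hdeg45] at hlt hc
            rw [two_apply haa, if_neg haa.symm, if_pos rfl] at hd
            rw [two_apply haa, if_pos rfl] at hc
            obtain ⟨h7, h7eq⟩ := hG7 e he
            by_cases h8e : e.degree = 8
            · have hea : e a = 2 := by omega
              have hsplit := degree_eq_apply_add_apply_add_degIn haa e
              obtain ⟨i, hia, hia', hei⟩ := eq_pair_add_single_of_degIn_eq_one haa (e := e) (by omega)
              rw [hea, ← hd] at hei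
              exact (MvPolynomial.mem_support_iff.mp he) (by rw [hei]; exact h25 i hia hia')
            · have := (h7eq (by omega)).1; omega)] at h
        rw [h]; exact h45
      · -- `x_a²x_{a′}⁵x_i` at the child comes from `x_a x_{a′}⁵ x_i` of `J G`, a degree-`7` monomial of `G`: absent
        intro i hia hia'
        have hdeg7 : (Finsupp.single a 1 + Finsupp.single a' 5 + Finsupp.single i 1 : Fin 4 →₀ ℕ).degree = 7 := by
          rw [map_add, map_add, Finsupp.degree_single, Finsupp.degree_single, Finsupp.degree_single]
        have hEa : (Finsupp.single a 1 + Finsupp.single a' 5 + Finsupp.single i 1 : Fin 4 →₀ ℕ) a = 1 := by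
          rw [Finsupp.add_apply, two_apply haa, if_pos rfl, Finsupp.single_apply, if_neg hia, add_zero]
        have hχ : chartExponent 5 Finset.univ a (Finsupp.single a 1 + Finsupp.single a' 5 + Finsupp.single i 1) =
            Finsupp.single a 2 + Finsupp.single a' 5 + Finsupp.single i 1 := by
          ext l
          rw [chartExponent_apply, degIn_univ, hdeg7]
          by_cases hl : l = a
          · rw [if_pos hl, hl, Finsupp.add_apply, two_apply haa, if_pos rfl, Finsupp.single_apply, if_neg hia]
            omega
          · rw [if_neg hl]
            simp only [Finsupp.add_apply, Finsupp.single_apply, if_neg (Ne.symm hl)]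
        have h := hS (Finsupp.single a 1 + Finsupp.single a' 5 + Finsupp.single i 1) (by rw [hdeg7]; omega)
          (by rw [hχ]
              exact not_isPthPowerExponent_of_not_dvd (i := a)
                (by rw [Finsupp.add_apply, two_apply haa, if_pos rfl, Finsupp.single_apply, if_neg hia]; omega))
        rw [hχ, coeff_jet_of_le a φ₁ (fun e he => by rw [hdeg7]; exact (hG7 e he).1)] at h
        rw [h]
        by_contra hne
        have h2 := ((hG7 _ (MvPolynomial.mem_support_iff.mpr hne)).2 hdeg7).1
        rw [hEa] at h2
        omega
    · exact absurd (loseBoth_jet_kill hc hw hr0 hfloor hshade he haa hletters hpass hm hrm hVa' hφa hφa' hφV hja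
        htm).1 h45
  · exfalso
    by_cases htm : b m a = 0
    · exact false_of_keep hc hw hr0 hfloor hshade haa hpass hm hrm hja' htm
    · exact h45 (loseBoth_jet_kill_swap hc hw hr0 hfloor hshade he haa hletters hpass hm hrm hVa' hφa hφa' hφV hja'
        htm).1

/-- **TILTED END GAME, SEED `x_a⁴x_{a′}⁴`: NO STEP IS POSSIBLE** from a half-straight `(2,1)`-state whose frame cone
carries `x_a⁴x_{a′}⁴`: the corner child would carry `x_a³x_{a′}⁴` in ITS frame (`corner_frame_step`, no jet source),
a degree-`7` monomial of `x_a`-exponent `3 ≠ 2` — against `free_of_straighten_one`; lose-both steps by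
`loseBoth_jet_kill(_swap)`, keeping `a` by `false_of_keep`. [OURS] [cite: CossartJannsenSaito2020, Lemma 13.2, Thm. 13.7] -/
theorem tilted_false_of_seed44 {c : ℕ → State K} {j : ℕ → Fin 4} {b : ℕ → Fin 4 → K}
    (hc : ∀ k, IsIsolated 5 (c k).F ∧ Step0 5 (c k) (c (k + 1))) (hw : FreeTail.IsWitnessedChain 5 c j b)
    (hr0 : ∀ e ∈ (c 0).F.support, (c 0).r ≤ e) (hfloor : ∀ k, ordZero (c k).F ≠ 5) {k₀ : ℕ}
    (hshade : ∀ k, k₀ ≤ k → (c k).shade = ((4 : ℕ) : ℕ∞))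
    (he : ∀ k, k₀ ≤ k → Module.finrank K (resVertex (c k)) = 2) {a a' : Fin 4} (haa : a ≠ a')
    (hletters : ∀ k, k₀ ≤ k → (j k = a ∨ j k = a'))
    (hpass : ∀ k, k₀ ≤ k → ∀ i, i ≠ a → i ≠ a' → (c k).r i = 0)
    {m : ℕ} (hm : k₀ ≤ m) (hrm : (c m).r = Finsupp.single a 2 + Finsupp.single a' 1)
    (hVa' : (Pi.single a' 1 : Fin 4 → K) ∈ resVertex (c m)) {φ : Fin 4 → K} (hφa : φ a = 0) (hφa' : φ a' = 0)
    (hφV : (Pi.single a 1 : Fin 4 → K) + φ ∈ resVertex (c m))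
    (h44 : coeff (Finsupp.single a 4 + Finsupp.single a' 4) (shear a φ (c m).F) ≠ 0) : False := by
  haveI : Fact (Nat.Prime 5) := ⟨by norm_num⟩
  have hdeg44 : (Finsupp.single a 4 + Finsupp.single a' 4 : Fin 4 →₀ ℕ).degree = 8 := by
    rw [map_add, Finsupp.degree_single, Finsupp.degree_single]
  rcases hletters m hm with hja | hja'
  · by_cases htm : b m a' = 0
    · obtain ⟨-, hr1, -, φ₁, hφ₁a, hφ₁a', hφ₁V, hS⟩ := corner_frame_step hc hw hr0 hfloor hshade he haa hletters
        hpass hm hrm hVa' hφa hφa' hφV hja htm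
      have hG7 := straight_rows hc hr0 hfloor hshade haa hpass hm hrm hVa' hφa hφa' hφV
      have h := hS (Finsupp.single a 4 + Finsupp.single a' 4) (by rw [hdeg44]; omega)
        (by rw [chartExponent_two_left haa 4 4 3 rfl]
            exact not_isPthPowerExponent_of_not_dvd (i := a) (by rw [two_apply haa, if_pos rfl]; omega))
      rw [chartExponent_two_left haa 4 4 3 rfl, coeff_jet_eq_of_noSource haa φ₁ hφ₁a hφ₁a'
        (fun e he hlt hd hc => by
          rw [hdeg44] at hlt hc
          rw [two_apply haa, if_neg haa.symm, if_pos rfl] at hd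
          obtain ⟨h7, h7eq⟩ := hG7 e he
          have := (h7eq (by omega)).2; omega)] at h
      have hmem : Finsupp.single a 3 + Finsupp.single a' 4 ∈ (shear a φ₁ (c (m + 1)).F).support := by
        rw [MvPolynomial.mem_support_iff, h]; exact h44
      obtain ⟨o₁, ho₁, ho₁sum, -, -, hrk₁, -⟩ := chain_basics hc hr0 hfloor hshade haa hpass (k := m + 1) (by omega)
      have hr1a : (c (m + 1)).r a = 2 := by rw [hr1, two_apply haa, if_pos rfl]
      have hr1a' : (c (m + 1)).r a' = 1 := by rw [hr1, two_apply haa, if_neg haa.symm, if_pos rfl]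
      have ho₁7 : o₁ = 7 := by omega
      obtain ⟨-, -, h7eq⟩ := free_of_straighten_one 5 ho₁
        (by rw [ordZero_sub_degree_eq_of_shade ho₁ (hshade (m + 1) (by omega))]; norm_num) hrk₁ hφ₁a
        (fun i hia hφi => hpass (m + 1) (by omega) i hia (by rintro rfl; exact hφi hφ₁a')) hφ₁V _ hmem
      have h3 := h7eq (by rw [map_add, Finsupp.degree_single, Finsupp.degree_single, ho₁7])
      rw [two_apply haa, if_pos rfl, hr1a] at h3
      omega
    · exact h44 (loseBoth_jet_kill hc hw hr0 hfloor hshade he haa hletters hpass hm hrm hVa' hφa hφa' hφV hja htm).2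
  · by_cases htm : b m a = 0
    · exact false_of_keep hc hw hr0 hfloor hshade haa hpass hm hrm hja' htm
    · exact h44 (loseBoth_jet_kill_swap hc hw hr0 hfloor hshade he haa hletters hpass hm hrm hVa' hφa hφa' hφV hja'
        htm).2

/-- **AFTER A LOSE-BOTH STEP A (POSSIBLY TILTED) LOSSY PAIR TAIL IS IMPOSSIBLE** (oriented: the lose-both is in chart
`a` translating `a′`).  Read the tail in the frame of `exists_tilted_frame_at`; `tilted_loseBoth_package` makes the
grandchild half-straight with a seed: seed 44 — `tilted_false_of_seed44`; seed 45 — by `tilted_corner_of_seed45`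
every later step is the corner at the frame point, translating no boundary letter: against LOSSY. [OURS]
[cite: CossartJannsenSaito2020, Thm. 13.7] [cite: Hauser2010, §I (kangaroo phenomenon)] -/
theorem false_of_tilted_loseBoth {c : ℕ → State K} {j : ℕ → Fin 4} {b : ℕ → Fin 4 → K}
    (hc : ∀ k, IsIsolated 5 (c k).F ∧ Step0 5 (c k) (c (k + 1))) (hw : FreeTail.IsWitnessedChain 5 c j b)
    (hr0 : ∀ e ∈ (c 0).F.support, (c 0).r ≤ e) (hfloor : ∀ k, ordZero (c k).F ≠ 5) {k₀ : ℕ}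
    (hshade : ∀ k, k₀ ≤ k → (c k).shade = ((4 : ℕ) : ℕ∞))
    (he : ∀ k, k₀ ≤ k → Module.finrank K (resVertex (c k)) = 2) {a a' : Fin 4} (haa : a ≠ a')
    (hletters : ∀ k, k₀ ≤ k → (j k = a ∨ j k = a'))
    (hpass : ∀ k, k₀ ≤ k → ∀ i, i ≠ a → i ≠ a' → (c k).r i = 0)
    (hlossy : ∀ N, ∃ k, N ≤ k ∧ ∃ i, i ≠ j k ∧ b k i ≠ 0 ∧ 1 ≤ (c k).r i)
    {k : ℕ} (hk : k₀ ≤ k) (hjk : j k = a) (ht : b k a' ≠ 0) : False := by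
  haveI : Fact (Nat.Prime 5) := ⟨by norm_num⟩
  obtain ⟨φ, ψ, hφa, hφa', hψa, hψa', hφV, hψV⟩ := exists_tilted_frame_at 5 hc hw hr0 hfloor hshade he haa hletters hk hjk
  obtain ⟨φ', hφ'a, hφ'a', hφ'V2, hVa'2, -, hr2, -, -, hseed, -, hdeg8⟩ := tilted_loseBoth_package hc hw hr0 hfloor
    hshade he haa hletters hpass hk hjk ht hφa hφa' hψa hψa' hφV hψV
  rcases hseed with h44 | h45
  · exact tilted_false_of_seed44 hc hw hr0 hfloor hshade he haa hletters hpass (m := k + 2) (by omega) hr2 hVa'2 hφ'a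
      hφ'a' hφ'V2 h44
  · -- the birth state has no `x_a²x_{a′}⁵x_i` (degree-`8` rows of `x_a`-exponent `2` have `x_{a′}`-exponent `2`)
    have h25 : ∀ i, i ≠ a → i ≠ a' →
        coeff (Finsupp.single a 2 + Finsupp.single a' 5 + Finsupp.single i 1) (shear a φ' (c (k + 2)).F) = 0 := by
      intro i hia hia'
      by_contra hne
      have h := hdeg8 _ (MvPolynomial.mem_support_iff.mpr hne)
        (by rw [map_add, map_add, Finsupp.degree_single, Finsupp.degree_single, Finsupp.degree_single])
        (by rw [Finsupp.add_apply, two_apply haa, if_pos rfl, Finsupp.single_apply, if_neg hia, add_zero])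
      rw [Finsupp.add_apply, two_apply haa, if_neg haa.symm, if_pos rfl, Finsupp.single_apply, if_neg hia'] at h
      omega
    -- the invariant along the rest of the tail
    have hind : ∀ n, (c (k + 2 + n)).r = Finsupp.single a 2 + Finsupp.single a' 1 ∧
        (Pi.single a' 1 : Fin 4 → K) ∈ resVertex (c (k + 2 + n)) ∧
        ∃ φn : Fin 4 → K, φn a = 0 ∧ φn a' = 0 ∧ (Pi.single a 1 : Fin 4 → K) + φn ∈ resVertex (c (k + 2 + n)) ∧
          coeff (Finsupp.single a 4 + Finsupp.single a' 5) (shear a φn (c (k + 2 + n)).F) ≠ 0 ∧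
          ∀ i, i ≠ a → i ≠ a' → coeff (Finsupp.single a 2 + Finsupp.single a' 5 + Finsupp.single i 1)
            (shear a φn (c (k + 2 + n)).F) = 0 := by
      intro n
      induction n with
      | zero => exact ⟨hr2, hVa'2, φ', hφ'a, hφ'a', hφ'V2, h45, h25⟩
      | succ n ih =>
        obtain ⟨hrn, hVn, φn, hφna, hφna', hφnV, h45n, h25n⟩ := ih
        obtain ⟨-, hr', hV', φ₁, hφ₁a, hφ₁a', hφ₁V, h45', h25'⟩ := tilted_corner_of_seed45 hc hw hr0 hfloor hshade he
          haa hletters hpass (m := k + 2 + n) (by omega) hrn hVn hφna hφna' hφnV h45n h25n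
        rw [show k + 2 + (n + 1) = k + 2 + n + 1 by omega]
        exact ⟨hr', hV', φ₁, hφ₁a, hφ₁a', hφ₁V, h45', h25'⟩
    obtain ⟨m, hm, i, -, hbi, hri⟩ := hlossy (k + 2)
    obtain ⟨n, rfl⟩ : ∃ n, m = k + 2 + n := ⟨m - (k + 2), by omega⟩
    obtain ⟨hrn, hVn, φn, hφna, hφna', hφnV, h45n, h25n⟩ := hind n
    obtain ⟨hb, -⟩ := tilted_corner_of_seed45 hc hw hr0 hfloor hshade he haa hletters hpass (m := k + 2 + n)
      (by omega) hrn hVn hφna hφna' hφnV h45n h25n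
    rw [hb] at hbi
    by_cases hia : i = a
    · rw [hia] at hbi; exact hbi hφna
    · by_cases hia' : i = a'
      · rw [hia'] at hbi; exact hbi hφna'
      · have := hpass (k + 2 + n) (by omega) i hia hia'; omega

/-- **NO LOSSY BINARY-CONE PAIR TAIL AT `(p, d) = (5, 4)` — TILTED OR NOT** (brick (ii) headline, lossy form).  Over a
field of characteristic `5`: there is NO isolated above-floor witnessed `Step0 5` chain with `x^{r₀} ∣ F₀`, of constant
shade `4` and `e_G = 2` from `k₀` on, chart letters in `{a, a′}`, PASSIVE-FREE, that is LOSSY.  (Brick (i)'s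
`no_lossy_tiltFree_pair_tail_four_five` without the hypothesis `htilt`: the first loss after `k₀` is a lose-both
step; `false_of_tilted_loseBoth` in the right orientation.) [OURS]
[cite: CossartJannsenSaito2020, Thm. 3.14, Lemma 13.2, Thm. 13.7] [cite: Hauser2010, §I (kangaroo phenomenon)] -/
theorem no_lossy_pair_tail_four_five {c : ℕ → State K} {j : ℕ → Fin 4} {b : ℕ → Fin 4 → K}
    (hc : ∀ k, IsIsolated 5 (c k).F ∧ Step0 5 (c k) (c (k + 1))) (hw : FreeTail.IsWitnessedChain 5 c j b)
    (hr0 : ∀ e ∈ (c 0).F.support, (c 0).r ≤ e) (hfloor : ∀ k, ordZero (c k).F ≠ 5) {k₀ : ℕ}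
    (hshade : ∀ k, k₀ ≤ k → (c k).shade = ((4 : ℕ) : ℕ∞))
    (he : ∀ k, k₀ ≤ k → Module.finrank K (resVertex (c k)) = 2) {a a' : Fin 4} (haa : a ≠ a')
    (hletters : ∀ k, k₀ ≤ k → (j k = a ∨ j k = a'))
    (hpass : ∀ k, k₀ ≤ k → ∀ i, i ≠ a → i ≠ a' → (c k).r i = 0)
    (hlossy : ∀ N, ∃ k, N ≤ k ∧ ∃ i, i ≠ j k ∧ b k i ≠ 0 ∧ 1 ≤ (c k).r i) : False := by
  obtain ⟨k, hk, i, hij, hbi, hri⟩ := hlossy k₀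
  have hi : i = a ∨ i = a' := by
    by_contra h
    push Not at h
    have := hpass k hk i h.1 h.2
    omega
  rcases hi with rfl | rfl
  · have hja' : j k = a' := by
      rcases hletters k hk with h | h
      · exact absurd h.symm hij
      · exact h
    exact false_of_tilted_loseBoth hc hw hr0 hfloor hshade he haa.symm (fun k hk => (hletters k hk).symm)
      (fun k hk i h1 h2 => hpass k hk i h2 h1) hlossy hk hja' hbi
  · have hja : j k = a := by
      rcases hletters k hk with h | h
      · exact h
      · exact absurd h.symm hij
    exact false_of_tilted_loseBoth hc hw hr0 hfloor hshade he haa hletters hpass hlossy hk hja hbi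

/-- **NO PASSIVE-FREE BINARY-CONE PAIR TAIL AT `(p, d) = (5, 4)` — HEADLINE OF BRICK (ii).**  Over a field of
characteristic `5` there is NO isolated above-floor witnessed `Step0 5` chain with `x^{r₀} ∣ F₀`, of constant shade `4`
and `e_G = 2` from `k₀` on, with chart letters in a pair `{a, a′}` and the two other letters never boundary — with NO
hypothesis on the tilt of the polar kernels.  Lossy: `no_lossy_pair_tail_four_five`; eventually loss-free:
res-dim4-p-5 g3's `…LossFreeTail.no_lossfree_tail`.  Riders: `p = 5 = d + 1` is used (Frobenius sextic row, legality
numerology); chart letters outside the pair / a passive boundary letter (B∞) are the remaining cases of slice C at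
`(5, 4)`; K2(5) stays OPEN. [OURS] [cite: CossartJannsenSaito2020, Thm. 3.14, Lemma 13.2, Thm. 13.7]
[cite: Hauser2010, §I (definition of P⁺, kangaroo phenomenon)] -/
theorem no_pair_tail_four_five {c : ℕ → State K} {j : ℕ → Fin 4} {b : ℕ → Fin 4 → K}
    (hc : ∀ k, IsIsolated 5 (c k).F ∧ Step0 5 (c k) (c (k + 1))) (hw : FreeTail.IsWitnessedChain 5 c j b)
    (hr0 : ∀ e ∈ (c 0).F.support, (c 0).r ≤ e) (hfloor : ∀ k, ordZero (c k).F ≠ 5) {k₀ : ℕ}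
    (hshade : ∀ k, k₀ ≤ k → (c k).shade = ((4 : ℕ) : ℕ∞))
    (he : ∀ k, k₀ ≤ k → Module.finrank K (resVertex (c k)) = 2) {a a' : Fin 4} (haa : a ≠ a')
    (hletters : ∀ k, k₀ ≤ k → (j k = a ∨ j k = a'))
    (hpass : ∀ k, k₀ ≤ k → ∀ i, i ≠ a → i ≠ a' → (c k).r i = 0) : False := by
  haveI : Fact (Nat.Prime 5) := ⟨by norm_num⟩
  by_cases hlossy : ∀ N, ∃ k, N ≤ k ∧ ∃ i, i ≠ j k ∧ b k i ≠ 0 ∧ 1 ≤ (c k).r i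
  · exact no_lossy_pair_tail_four_five hc hw hr0 hfloor hshade he haa hletters hpass hlossy
  · push Not at hlossy
    obtain ⟨N, hN⟩ := hlossy
    refine no_lossfree_tail 5 hc hw hr0 hfloor (k₀ := max k₀ N) (d := 4) (by norm_num)
      (fun k hk => hshade k (le_of_max_le_left hk)) (fun k hk => he k (le_of_max_le_left hk)) fun k hk i hbi => ?_
    by_cases hij : i = j k
    · rw [hij] at hbi; exact absurd (hw k).2.1 hbi
    · have := hN k (le_of_max_le_right hk) i hij hbi; omega

end TiltedEndGame

end ResCone

end Summit.ResolutionOfSingularities.ResolutionOfSingularities.Theorems.PIDim4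

end
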